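import Mathlib
import Summits.Ventures.PercRepro2.PendantO
import Summits.Ventures.PercRepro2.PMK5PendantO
import Summits.Ventures.PercRepro2.PMK5PendantBMasses

/-!
# THEOREM 21 — THE EQUALITY LOCUS OF (HCOV) ON THE SIX-VERTEX FAMILY `K₅ + a₃ PENDANT AT o`
(blind cell PercRepro2, mine-2 g24; the lens «equality locus first» on the third six-vertex pendant family
(`K5.PendO.ends6o`: `K₅` on `o = 0, a₁ = 1, a₂ = 2, u = 3, b = 4` plus the pendant edge `{0, 5}` to the leaf
`a₃ = 5` at `o`), every weight vector; on mine-a / typer-1's pendant-at-`o` identity `PendantO.Gc_pendant_o` and the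
masses, slacks and bridges of `PMK5PendantBMasses.lean`)

Write `q = p 10` for the pendant weight and `s = p ∘ castSucc` for the `K₅` weights.  The identity
`Gc = −2 (1 − q) P(Q) [covC(oH, bL) + covC(oL, bH)]` reads, in the slacks (**`gc6o_eq`**),
  `Gc(p) = (1 − q) · 2P (Z_L + Z_H)` — `(1 − q)` times the `a₃`-INACTIVE VALUE `I` of the base.
Hence the locus of (HCOV) on `K₅ + a₃ pendant at o` is the `a₃`-isolated locus `RuleA` (the root pair separates `o`
from `b`, or a root cannot reach `o` avoiding the other root — 560 / 1,024) for EVERY pendant weight `q < 1`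
(**`gc6o_pos_iff`** / **`gc6o_zero_iff`**; zero side for every `q ∈ [0, 1]`), and at `q = 1` (`a₃ = o`) the crux
functional vanishes identically (**`gc6o_glued_zero`**).  Census (second code, the exact centre values of `Gc` on
`ends6o` at `q = 0, ½`): zero faces 560 / 560 = `RuleA` on 1,024 / 1,024.  Standard axioms.
-/

namespace Summit.Ventures.PercRepro2

open Hub CovForm

namespace K5

namespace PM

section Family

variable {R : Type*} [Field R] [LinearOrder R] [IsStrictOrderedRing R]

omit [LinearOrder R] [IsStrictOrderedRing R] in
/-- The connection events among the marks transfer (numeral forms). -/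
lemma c12o : connEvent PendO.ends6o 1 2 = PendO.reso ⁻¹' connEvent ends5 1 2 := by
  have h := PendO.connEvent6o_eq 1 2; rwa [Pendant.cs1, Pendant.cs2] at h
omit [LinearOrder R] [IsStrictOrderedRing R] in
/-- The connection events among the marks transfer (numeral forms). -/
lemma c14o : connEvent PendO.ends6o 1 4 = PendO.reso ⁻¹' connEvent ends5 1 4 := by
  have h := PendO.connEvent6o_eq 1 4; rwa [Pendant.cs1, Pendant.cs4] at h
omit [LinearOrder R] [IsStrictOrderedRing R] in
/-- The connection events among the marks transfer (numeral forms). -/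
lemma c24o : connEvent PendO.ends6o 2 4 = PendO.reso ⁻¹' connEvent ends5 2 4 := by
  have h := PendO.connEvent6o_eq 2 4; rwa [Pendant.cs2, Pendant.cs4] at h
omit [LinearOrder R] [IsStrictOrderedRing R] in
/-- The connection events among the marks transfer (numeral forms). -/
lemma c10o : connEvent PendO.ends6o 1 0 = PendO.reso ⁻¹' connEvent ends5 1 0 := by
  have h := PendO.connEvent6o_eq 1 0; rwa [Pendant.cs1, Pendant.cs0] at h
omit [LinearOrder R] [IsStrictOrderedRing R] in
/-- The connection events among the marks transfer (numeral forms). -/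
lemma c20o : connEvent PendO.ends6o 2 0 = PendO.reso ⁻¹' connEvent ends5 2 0 := by
  have h := PendO.connEvent6o_eq 2 0; rwa [Pendant.cs2, Pendant.cs0] at h
omit [LinearOrder R] [IsStrictOrderedRing R] in
/-- `Q` transfers. -/
lemma avoidAll6o : avoidAll PendO.ends6o 2 {1} = PendO.reso ⁻¹' avoidAll ends5 2 {1} := by
  rw [PMPendant.avoidAll_eq_compl, PMPendant.avoidAll_eq_compl, c12o, Set.preimage_compl]

omit [LinearOrder R] [IsStrictOrderedRing R] in
/-- The pendant edge of `ends6o` joins `a₃ = 5` to `o = 0`. -/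
lemma ends6o_last' : PendO.ends6o (Fin.last 10) = s(5, 0) := by
  rw [PendO.ends6o_last, Sym2.eq_swap]

/-- **The crux functional on `K₅ + a₃ pendant at o` is `(1 − q)` times the `a₃`-inactive value of the base.** -/
theorem gc6o_eq (p : Fin 11 → R) :
    Gc p PendO.ends6o 0 1 2 5 4 =
      (1 - p (Fin.last 10)) * (2 * Pm (p ∘ Fin.castSucc) * (ZL (p ∘ Fin.castSucc) + ZH (p ∘ Fin.castSucc))) := by
  rw [PendantO.Gc_pendant_o p PendO.ends6o ends6o_last' PendO.leaf_five_o (by decide) (by decide) (by decide)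
    (by decide)]
  unfold PendantRoot.covC
  simp only [avoidAll6o, c14o, c24o, c10o, c20o, ← Set.preimage_inter, PendO.prob_reso]
  unfold ZL ZH Pm oLm bHm Ddm oHm bLm Cm Qev
  ring

end Family

section Locus

variable {R : Type*} [Field R] [LinearOrder R] [IsStrictOrderedRing R]

/-- The centre of the base face with pendant weight `½`. -/
noncomputable def centreO (m : ℕ) : Fin 11 → R := Fin.snoc (α := fun _ => R) (centre m) (1 / 2)

omit [LinearOrder R] [IsStrictOrderedRing R] in
/-- `centreO` on the `K₅` edges is the centre of `m`. -/
lemma centreO_castSucc (m : ℕ) (e : Fin 10) : centreO (R := R) m (Fin.castSucc e) = centre m e := by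
  unfold centreO; simp [Fin.snoc_castSucc]

omit [LinearOrder R] [IsStrictOrderedRing R] in
/-- The pendant weight of `centreO` is `½`. -/
lemma centreO_last (m : ℕ) : centreO (R := R) m (Fin.last 10) = 1 / 2 :=
  Fin.snoc_last _ _

/-- `centreO` is admissible. -/
lemma centreO_01 (m : ℕ) : ∀ e : Fin 11, 0 ≤ centreO (R := R) m e ∧ centreO (R := R) m e ≤ 1 := by
  intro e
  induction e using Fin.lastCases with
  | last => rw [centreO_last]; exact ⟨by norm_num, by norm_num⟩
  | cast e => rw [centreO_castSucc]; exact centre_01 m e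

/-- **THEOREM 21 — THE ZERO SIDE**: on every `A`-degenerate base edge set `m`, `Gc p ends6o 0 1 2 5 4 = 0` for every
`p` whose `K₅` weights are supported on `m` — for every pendant weight. -/
theorem gc6o_zero_of_face (m : ℕ) (hm : m < 1024) (hr : RuleA m = true) (p : Fin 11 → R)
    (hp₀ : ∀ e : Fin 10, m.testBit e = false → p (Fin.castSucc e) = 0) :
    Gc p PendO.ends6o 0 1 2 5 4 = 0 := by
  rw [gc6o_eq, twoPZ_eq_bern, i_K5_zero_of_face m hm hr (p ∘ Fin.castSucc) (fun e he => hp₀ e he), mul_zero]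

/-- **THEOREM 21 — THE POSITIVE SIDE**: on every base edge set `m` that is not `A`-degenerate,
`0 < Gc p ends6o 0 1 2 5 4` at every weight vector interior on the base with pendant weight `q < 1`. -/
theorem gc6o_pos_of_face (m : ℕ) (hm : m < 1024) (hr : RuleA m = false) (p : Fin 11 → R)
    (hp₁ : ∀ e : Fin 10, m.testBit e = true → 0 < p (Fin.castSucc e) ∧ p (Fin.castSucc e) < 1)
    (hp₀ : ∀ e : Fin 10, m.testBit e = false → p (Fin.castSucc e) = 0)
    (hq : p (Fin.last 10) < 1) : 0 < Gc p PendO.ends6o 0 1 2 5 4 := by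
  rw [gc6o_eq, twoPZ_eq_bern]
  exact mul_pos (sub_pos.2 hq)
    (i_K5_pos_of_face m hm hr (p ∘ Fin.castSucc) (fun e he => hp₁ e he) (fun e he => hp₀ e he))

/-- **THEOREM 21, FIRST «IFF»**: on `K₅ + a₃ pendant at o`, `Gc > 0` at every weight vector interior on the base face
of `m` with pendant weight `q < 1` ⟺ `m` is not `A`-degenerate. -/
theorem gc6o_pos_iff (m : ℕ) (hm : m < 1024) :
    (∀ p : Fin 11 → R, (∀ e : Fin 10, m.testBit e = true → 0 < p (Fin.castSucc e) ∧ p (Fin.castSucc e) < 1) →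
      (∀ e : Fin 10, m.testBit e = false → p (Fin.castSucc e) = 0) →
      p (Fin.last 10) < 1 → 0 < Gc p PendO.ends6o 0 1 2 5 4) ↔ RuleA m = false := by
  constructor
  · intro h
    rcases Bool.eq_false_or_eq_true (RuleA m) with hr | hr
    · exfalso
      have hpos := h (centreO (R := R) m) (fun e he => by rw [centreO_castSucc]; exact centre_on_pos he)
        (fun e he => by rw [centreO_castSucc]; exact centre_off he) (by rw [centreO_last]; norm_num)
      have hzero := gc6o_zero_of_face m hm hr (centreO (R := R) m)
        (fun e he => by rw [centreO_castSucc]; exact centre_off he)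
      rw [hzero] at hpos
      exact lt_irrefl _ hpos
    · exact hr
  · intro hr p hp₁ hp₀ hq
    exact gc6o_pos_of_face m hm hr p hp₁ hp₀ hq

/-- **THEOREM 21, SECOND «IFF»**: on `K₅ + a₃ pendant at o`, `Gc = 0` at every admissible weight vector whose `K₅`
weights are supported on `m` ⟺ `m` is `A`-degenerate. -/
theorem gc6o_zero_iff (m : ℕ) (hm : m < 1024) :
    (∀ p : Fin 11 → R, (∀ e : Fin 11, 0 ≤ p e ∧ p e ≤ 1) →
      (∀ e : Fin 10, m.testBit e = false → p (Fin.castSucc e) = 0) →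
      Gc p PendO.ends6o 0 1 2 5 4 = 0) ↔ RuleA m = true := by
  constructor
  · intro h
    rcases Bool.eq_false_or_eq_true (RuleA m) with hr | hr
    · exact hr
    · exfalso
      have hpos := gc6o_pos_of_face m hm hr (centreO (R := R) m)
        (fun e he => by rw [centreO_castSucc]; exact centre_on_pos he)
        (fun e he => by rw [centreO_castSucc]; exact centre_off he) (by rw [centreO_last]; norm_num)
      have hzero := h (centreO (R := R) m) (centreO_01 m)
        (fun e he => by rw [centreO_castSucc]; exact centre_off he)
      rw [hzero] at hpos
      exact lt_irrefl _ hpos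
  · intro hr p _ hp₀
    exact gc6o_zero_of_face m hm hr p hp₀

/-- **The glued face `q = 1` (`a₃ = o`)**: the crux functional vanishes identically. -/
theorem gc6o_glued_zero (p : Fin 11 → R) :
    Gc (Function.update p (Fin.last 10) 1) PendO.ends6o 0 1 2 5 4 = 0 := by
  rw [gc6o_eq, Function.update_self]
  ring

end Locus

end PM

end K5

end Summit.Ventures.PercRepro2
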